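/- Copyright: the b2b-balaban cell (near-miss cell 7), T⁴-continuum fan-out, lineage t4-ne7b-p1 (node U5c COUNT
member).  Released under the licence of the surrounding project. -/
import Summits.QuantumFields.BalabanUV.T4Continuum.Support.HistoryGenealogyExtraction

/-!
# Genealogy extraction — TIMING (H3-(ID), combinatorial half): print's discipline `Adm` holds for every extracted
genealogy (owner module of row NE7b, lineage `t4-ne7b-p1` gen 39, ruling R-OWNER-39-1; re-open object (α),
`SCOPE-alpha.md` v2 §5 row M3a — PRE-POSITIONING ONLY; sibling of `…HistoryGenealogyExtraction`)

Summits-side support leaf of the T⁴-continuum cell (rung (B)+1 on a FINITE torus only; NOT infinite volume, NOT the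
mass gap, NOT the Clay statement; NOT a proof of the spine estimate NE7b, which is the cell's OWN estimate, NOT PRINTED
and NOT PROVED).  [folklore] finite combinatorics over `HistoryAdmissible.PGen` and part 1's `ComponentHistory.pgen`;
nothing printed is asserted, no `def … : Prop` fact of Bałaban's, no cite-tagged hypothesis, zero `sorry`.

WHAT IS PROVED.  `lastStep_joinTail_le`, `adm_joinTail`, `rootStep_joinTail_le`, `lastStep_assemble_le`, `adm_assemble`,
`rootStep_assemble_le` (the join chain and print's trichotomy preserve the timing facts of their constituents); then for
the extraction: **`lastStep_pgen_le`** (`(pgen H j c).lastStep ≤ j` — every event happens by its level),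
**`rootStep_pgen_le`**, and **`adm_pgen`**: `j ≤ K → (pgen H j c).Adm K` — print's timing discipline
`HistoryAdmissible.PGen.Adm` (births observed; a renewal after every event of the renewed line, by the cutoff; a join after
every event of both partners) holds for EVERY extracted genealogy, with no well-formedness hypothesis.

HONEST.  Proves nothing of Bałaban's; BY-NAME EFFECT ON THE WALL: NONE (pre-positioning for (α)); NE7b NOT proved; spine
0∕9.  HONEST DEPENDENCY (cell): continuum YM on T⁴ ⇐ BetaPertH ∧ nine spine estimates (0/9 proved); BetaPertH ⇐ (D1) ∧
(D4) ∧ CAP+tail; G-an2-4 gates asym, D1 and NE2/3/4.  This file changes none of it.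
-/

open Finset
open Literature.MathematicalPhysics.QuantumFieldTheory.Balaban1983to89

namespace Summit.QuantumFields.BalabanUV.T4Continuum.HistoryGenealogyExtraction

open HistoryAdmissible HistoryAdmissible.PGen

/-! ## Timing: last step, root step, and print's discipline `Adm` -/

section Timing

variable {γ : Type*}

/-- the last step of a join chain at `s` is `s` as soon as there is a second constituent [folklore] -/
theorem lastStep_joinTail_cons (T U : PGen γ) (L : List (PGen γ)) (s : ℕ) :
    (joinTail T (U :: L) s).lastStep = s := rfl

/-- the last step of a join chain is at most `s` if the head's is [folklore] -/
theorem lastStep_joinTail_le (T : PGen γ) (L : List (PGen γ)) (s : ℕ) (hT : T.lastStep ≤ s) :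
    (joinTail T L s).lastStep ≤ s := by
  cases L with
  | nil => simpa using hT
  | cons U L => simp [lastStep]

/-- `Adm K` of a join chain at `s ≤ K` from `Adm K` and `lastStep ≤ s` of every constituent [folklore] -/
theorem adm_joinTail {K s : ℕ} (hs : s ≤ K) :
    ∀ (T : PGen γ) (L : List (PGen γ)), T.Adm K → T.lastStep ≤ s → (∀ U ∈ L, U.Adm K ∧ U.lastStep ≤ s) →
      (joinTail T L s).Adm K
  | T, [], hT, _, _ => by simpa using hT
  | T, U :: L, hT, hTs, hL => by
      have hU := hL U (by simp)
      have ih := adm_joinTail hs U L hU.1 hU.2 (fun V hV => hL V (by simp [hV]))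
      exact ⟨hT, ih, hTs, lastStep_joinTail_le U L s hU.2, hs⟩

/-- the root step of a join chain is at most the head's [folklore] -/
theorem rootStep_joinTail_le (T : PGen γ) (L : List (PGen γ)) (s : ℕ) :
    (joinTail T L s).rootStep ≤ T.rootStep := by
  cases L with
  | nil => simp
  | cons U L => simp [rootStep]

/-- the last step of an assembled genealogy at step `s` is at most `s`, if every constituent's is and `h + 1 ≤ s`
in the renewal case [folklore] -/
theorem lastStep_assemble_le (c : γ) {s h : ℕ} :
    ∀ (L : List (PGen γ)) (r : Bool), (r = true → h + 1 ≤ s) → (∀ U ∈ L, U.lastStep ≤ s) →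
      (assemble c s h L r).lastStep ≤ s
  | [], _, _, _ => by simp [assemble, lastStep]
  | [T], r, hh, hL => by
      have hT := hL T (by simp)
      cases r
      · simpa [assemble] using hT
      · simpa [assemble, lastStep] using hh rfl
  | T :: U :: L, _, _, _ => by simp [assemble, lastStep]

/-- `Adm K` of an assembled genealogy at step `s ≤ K` (readiness `h`, `h + 1 = s` in the renewal case) from `Adm K`
and `lastStep ≤ s` of all constituents and `lastStep ≤ h` of them in the renewal case [folklore] -/
theorem adm_assemble (c : γ) {K s h : ℕ} (hs : s ≤ K) :
    ∀ (L : List (PGen γ)) (r : Bool), (r = true → h + 1 = s) → (∀ U ∈ L, U.Adm K ∧ U.lastStep ≤ s) →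
      (r = true → ∀ U ∈ L, U.lastStep ≤ h) → (assemble c s h L r).Adm K
  | [], _, _, _, _ => by simpa [assemble, Adm] using hs
  | [T], r, hh, hL, hr => by
      have hT := hL T (by simp)
      cases r
      · simpa [assemble] using hT.1
      · have h1 := hr rfl T (by simp)
        have h2 := hh rfl
        simp only [assemble, if_true, Adm]
        exact ⟨hT.1, h1, by omega⟩
  | T :: U :: L, _, _, hL, _ => by
      have hT := hL T (by simp)
      simp only [assemble_cons_cons]
      exact adm_joinTail hs T (U :: L) hT.1 hT.2 (fun V hV => hL V (by simp [hV]))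

/-- the root step of an assembled genealogy is at most `s` if every constituent's is [folklore] -/
theorem rootStep_assemble_le (c : γ) (s h : ℕ) :
    ∀ (L : List (PGen γ)) (r : Bool), (∀ U ∈ L, U.rootStep ≤ s) → (assemble c s h L r).rootStep ≤ s
  | [], _, _ => by simp [assemble, rootStep]
  | [T], r, hL => by
      have hT := hL T (by simp)
      cases r
      · simpa [assemble] using hT
      · simpa [assemble, rootStep] using hT
  | T :: U :: L, _, hL => by
      have hT := hL T (by simp)
      simp only [assemble_cons_cons]
      exact (rootStep_joinTail_le T (U :: L) s).trans hT

end Timing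

namespace ComponentHistory

variable {γ : Type*} [DecidableEq γ] (H : ComponentHistory γ)

omit [DecidableEq γ] in
/-- every birth constituent of step `s` has last step `s`, root step `s`, and is `Adm K` for `s ≤ K` [folklore] -/
theorem births_spec {K : ℕ} (s : ℕ) (c : γ) (U : PGen γ) (hU : U ∈ H.births s c) :
    U.lastStep = s ∧ U.rootStep = s ∧ (s ≤ K → U.Adm K) := by
  simp only [births, List.mem_map] at hU
  obtain ⟨n, -, rfl⟩ := hU
  exact ⟨rfl, rfl, fun h => h⟩

/-- **`lastStep (pgen H j c) ≤ j`** — every event of the extracted genealogy happens by its level. [folklore] -/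
theorem lastStep_pgen_le : ∀ (j : ℕ) (c : γ), (H.pgen j c).lastStep ≤ j
  | 0, c => by
      rw [pgen_zero_eq_assemble]
      refine lastStep_assemble_le c _ _ (fun h => by simp at h) ?_
      intro U hU
      exact ((H.births_spec (K := 0) 0 c U hU).1).le
  | j + 1, c => by
      rw [pgen_succ_eq_assemble]
      refine lastStep_assemble_le c _ _ (fun _ => le_rfl) ?_
      intro U hU
      rcases (H.mem_constituents_iff _ _ _ U).1 hU with ⟨p, -, rfl⟩ | hb
      · exact (lastStep_pgen_le j p).trans (by omega)
      · exact ((H.births_spec (K := 0) (j + 1) c U hb).1).le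

/-- **`rootStep (pgen H j c) ≤ j`.** [folklore] -/
theorem rootStep_pgen_le : ∀ (j : ℕ) (c : γ), (H.pgen j c).rootStep ≤ j
  | 0, c => by
      rw [pgen_zero_eq_assemble]
      refine rootStep_assemble_le c 0 0 _ _ ?_
      intro U hU
      exact ((H.births_spec (K := 0) 0 c U hU).2.1).le
  | j + 1, c => by
      rw [pgen_succ_eq_assemble]
      refine rootStep_assemble_le c (j + 1) j _ _ ?_
      intro U hU
      rcases (H.mem_constituents_iff _ _ _ U).1 hU with ⟨p, -, rfl⟩ | hb
      · exact (rootStep_pgen_le j p).trans (by omega)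
      · exact ((H.births_spec (K := 0) (j + 1) c U hb).2.1).le

/-- **PRINT'S TIMING DISCIPLINE HOLDS FOR EVERY EXTRACTED GENEALOGY**: `j ≤ K → (pgen H j c).Adm K` (births observed,
renewals after every event of the renewed line and by the cutoff, joins after every event of the partners). [folklore] -/
theorem adm_pgen {K : ℕ} : ∀ (j : ℕ) (c : γ), j ≤ K → (H.pgen j c).Adm K
  | 0, c, hK => by
      rw [pgen_zero_eq_assemble]
      refine adm_assemble c hK _ _ (fun h => by simp at h) ?_ (fun h => by simp at h)
      intro U hU
      have hs := H.births_spec (K := K) 0 c U hU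
      exact ⟨hs.2.2 hK, hs.1.le⟩
  | j + 1, c, hK => by
      rw [pgen_succ_eq_assemble]
      refine adm_assemble c hK _ _ (fun _ => rfl) ?_ ?_
      · intro U hU
        rcases (H.mem_constituents_iff _ _ _ U).1 hU with ⟨p, -, rfl⟩ | hb
        · exact ⟨adm_pgen j p (by omega), (H.lastStep_pgen_le j p).trans (by omega)⟩
        · have hs := H.births_spec (K := K) (j + 1) c U hb
          exact ⟨hs.2.2 hK, hs.1.le⟩
      · intro hr U hU
        have hr' : H.news (j + 1) c = [] ∧ H.fieldIn (j + 1) c = true := by simpa [ren] using hr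
        rcases (H.mem_constituents_iff _ _ _ U).1 hU with ⟨p, -, rfl⟩ | hb
        · exact H.lastStep_pgen_le j p
        · simp [births, hr'.1] at hb

end ComponentHistory

end Summit.QuantumFields.BalabanUV.T4Continuum.HistoryGenealogyExtraction
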